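import Literature.NumberTheory.Transcendental.PadicAuxiliaryCore
import Mathlib.Analysis.SpecialFunctions.Pow.Asymptotics
import Mathlib.Analysis.SpecialFunctions.Log.Basic
import HarnessLib

/-!
# The `p`-adic auxiliary function on `𝔾ₐ^{d₀} × 𝔾ₘ^{d₁}` (Waldschmidt 1988, Prop. 6.1, `p`-adic case): choice of the parameters

Topic `Literature/NumberTheory/Transcendental` (namespace `Literature.NumberTheory.Transcendental`,
grouping sub-namespace `LinGroupK`). Everything here is PROVED; no definitions, no named facts.

From the core construction with prescribed parameters
(`LinGroupK.exists_auxiliary_of_params`, `PadicAuxiliaryCore.lean`) this file derives the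
auxiliary functions in the asymptotic shape consumed by the §7 assembly
(`LinGroupK.weakObstruction_of_zeroEstimate_of_auxiliary` / `royObstruction_of_zeroEstimate_of_auxiliary`):
**`LinGroupK.exists_auxiliary`** — for data in normal form over `K = ℚ̄_p` and `n < d = d₀ + d₁`,
there are `C ≥ 1` and `S₀` such that for every `S ≥ S₀`, with `Δ = (C S^{d₁} (log S)^{2d₀})^{1/(d−n)}`
(the tree's `LinGroup.auxDelta`), some non-zero `P ∈ K[X, Y]` with `deg_X P ≤ Δ/(log S)²`,
`deg_Y P ≤ Δ/S` vanishes to order `≥ T ≥ Δ/log S` along `W` at all `γ(h)`, `0 ≤ hᵢ ≤ S`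
([Waldschmidt1988, §6 Prop. 6.1] with `a = 1`, `b = 2`, `d₂ = κ = 0`, `p`-adic case).

The parameters are `T = ⌈Δ/log S⌉`, `D₀ = ⌊Δ/(log S)²⌋`, `D₁ = ⌊Δ/S⌋`, `Q = ⌈e^Δ⌉` (size of the
integer coefficients), `L = ⌈c_L Δ⌉` (`p`-adic precision `p^{-L}`), where
`c_L = ([k₀:ℚ](A₀ + 2 log C) + 1)/log p` makes the Liouville count (P2) hold — the house of the
word values has logarithm `≤ (A₀ + 2 log C) Δ` — and `C` is chosen so large that the box-principle
count (P1), which after the substitution `Δ^{d−n} = C S^{d₁}(log S)^{2d₀}` reads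
`C > f log p (c_L + 2a + 1)(c_L + 3)^n · max(d₀,1)^{d₀} max(d₁,1)^{d₁}` (polylogarithmic in `C`),
holds (`exists_large_const`).

## References

* [Waldschmidt1988] M. Waldschmidt, *On the transcendence methods of Gel'fond and Schneider in
  several variables*, New Advances in Transcendence Theory (A. Baker ed.), CUP 1988, 375–398, §6
  Proposition 6.1 (p. 389), with [15] there (Invent. Math. 63 (1981)) §3.
* [Roy1992] D. Roy, *Matrices whose coefficients are linear forms in logarithms*, J. Number Theory
  41 (1992) 22–47, §1 Theorem 1 (p. 25).
-/

noncomputable section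

open MvPolynomial Finset Module Real
open Literature.NumberTheory.Transcendental.LinGroup (auxDelta eventually_mul_log_pow_le)

namespace Literature.NumberTheory.Transcendental

namespace LinGroupK

/-! ### Real-variable lemmas -/

/-- **Polylogarithmic against linear**: for `κ₁, κ₂, κ₃ ≥ 0` there is `C ≥ e` with
`κ₁ (κ₂ + κ₃ log C)^N < C`. [folklore] -/
theorem exists_large_const (κ₁ κ₂ κ₃ : ℝ) (h₁ : 0 ≤ κ₁) (h₂ : 0 ≤ κ₂) (h₃ : 0 ≤ κ₃) (N : ℕ) :
    ∃ C : ℝ, Real.exp 1 ≤ C ∧ κ₁ * (κ₂ + κ₃ * Real.log C) ^ N < C := by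
  have ht := Real.tendsto_pow_mul_exp_neg_atTop_nhds_zero N
  set B : ℝ := κ₁ * (κ₂ + κ₃) ^ N + 1 with hB
  have hBpos : 0 < B := by positivity
  have hev : ∀ᶠ y : ℝ in Filter.atTop, y ^ N * Real.exp (-y) < B⁻¹ :=
    ht (Iio_mem_nhds (inv_pos.2 hBpos))
  obtain ⟨y, hy⟩ := (hev.and (Filter.eventually_ge_atTop 1)).exists
  obtain ⟨hy2, hy1⟩ := hy
  refine ⟨Real.exp y, Real.exp_le_exp.2 hy1, ?_⟩
  rw [Real.log_exp]
  have hκy : κ₂ + κ₃ * y ≤ (κ₂ + κ₃) * y := by nlinarith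
  have hpow : (κ₂ + κ₃ * y) ^ N ≤ (κ₂ + κ₃) ^ N * y ^ N := by
    rw [← mul_pow]; exact pow_le_pow_left₀ (by positivity) hκy N
  have hey : 0 < Real.exp y := Real.exp_pos y
  have h3 : y ^ N < B⁻¹ * Real.exp y := by
    have e : y ^ N = (y ^ N * Real.exp (-y)) * Real.exp y := by
      rw [mul_assoc, ← Real.exp_add, neg_add_cancel, Real.exp_zero, mul_one]
    rw [e]
    exact mul_lt_mul_of_pos_right hy2 hey
  calc κ₁ * (κ₂ + κ₃ * y) ^ N ≤ κ₁ * ((κ₂ + κ₃) ^ N * y ^ N) := mul_le_mul_of_nonneg_left hpow h₁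
    _ = (κ₁ * (κ₂ + κ₃) ^ N) * y ^ N := by ring
    _ ≤ (κ₁ * (κ₂ + κ₃) ^ N) * (B⁻¹ * Real.exp y) :=
        mul_le_mul_of_nonneg_left h3.le (by positivity)
    _ = ((κ₁ * (κ₂ + κ₃) ^ N) / B) * Real.exp y := by ring
    _ < 1 * Real.exp y := by
        refine mul_lt_mul_of_pos_right ?_ hey
        rw [div_lt_one hBpos, hB]
        linarith
    _ = Real.exp y := one_mul _

/-- `log(x + 1) ≤ x` for `x ≥ 0`. [folklore] -/
theorem log_add_one_le {x : ℝ} (hx : 0 ≤ x) : Real.log (x + 1) ≤ x := by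
  have := Real.add_one_le_exp x
  calc Real.log (x + 1) ≤ Real.log (Real.exp x) := Real.log_le_log (by linarith) this
    _ = x := Real.log_exp x

/-- Passing a strict inequality between powers of naturals through logarithms. [folklore] -/
theorem pow_lt_pow_of_log {a b u v : ℕ} (ha : 1 ≤ a) (hb : 1 ≤ b)
    (h : (u : ℝ) * Real.log a < v * Real.log b) : a ^ u < b ^ v := by
  have ha' : (0 : ℝ) < a := by exact_mod_cast ha
  have hb' : (0 : ℝ) < b := by exact_mod_cast hb
  have h1 : Real.log ((a : ℝ) ^ u) < Real.log ((b : ℝ) ^ v) := by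
    rwa [Real.log_pow, Real.log_pow]
  have h2 := (Real.log_lt_log_iff (pow_pos ha' u) (pow_pos hb' v)).1 h1
  exact_mod_cast h2

/-! ### The auxiliary function -/

section AF

variable (p : ℕ) [Fact p.Prime]

open AlgSize

set_option maxHeartbeats 3200000 in
/-- **The `p`-adic auxiliary functions of [Waldschmidt1988, Prop. 6.1]** (interpolation-free,
`a = 1`, `b = 2`, `d₂ = κ = 0`), for data in normal form over `K = ℚ̄_p` (see
`exists_auxiliary_of_params`) and `n < d₀ + d₁`: there are `C ≥ 1` and `S₀` such that for all
`S ≥ S₀` some non-zero `P ∈ K[X, Y]` with `deg_X P ≤ Δ/(log S)²`, `deg_Y P ≤ Δ/S`,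
`Δ = (C S^{d₁}(log S)^{2d₀})^{1/(d−n)}`, vanishes to order `≥ T ≥ Δ/log S` along `W = span_K(φ(w̃_l))`
at every `γ(h)`, `0 ≤ hᵢ ≤ S`. [cite: Waldschmidt1988, §6 Proposition 6.1 (p. 389)]
[cite: Roy1992, §1 Theorem 1 (p. 25)] -/
theorem exists_auxiliary {d₀ d₁ n m t : ℕ} (hn : n < d₀ + d₁)
    (Φ : Frame (PadicAlgCl p) n d₀ d₁) (M : IntermediateField ℚ_[p] (PadicAlgCl p))
    [FiniteDimensional ℚ_[p] M] (hΦM : (∀ i k, Φ.A i k ∈ M) ∧ ∀ j k, Φ.B j k ∈ M)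
    (hΦ : Φ.Small (((p : ℝ)⁻¹) ^ 2))
    (yt : Fin m → Fin n → PadicAlgCl p) (hyt : ∀ i k, ‖yt i k‖ ≤ 1)
    (α : Fin m → Fin d₁ → (PadicAlgCl p)ˣ)
    (hα : ∀ i j, ((α i j : PadicAlgCl p) : ℂ_[p]) = NormedSpace.exp (((Φ.vec (yt i)).2 j : ℂ_[p])))
    (wt : Fin t → Fin n → PadicAlgCl p) (hwt : ∀ l k, ‖wt l k‖ ≤ 1)
    {k₀ : Type} [Field k₀] [NumberField k₀] (e : k₀ →+* PadicAlgCl p)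
    (y₀ : Fin m → Fin d₀ → k₀) (hy₀ : ∀ i i₀, e (y₀ i i₀) = (Φ.vec (yt i)).1 i₀)
    (α₀ : Fin m → Fin d₁ → k₀ˣ) (hα₀ : ∀ i j, e (α₀ i j : k₀) = (α i j : PadicAlgCl p))
    (w₀ : Fin t → (Fin d₀ → k₀) × (Fin d₁ → k₀)) (hw₀ : ∀ l, tmapHom e (w₀ l) = Φ.vec (wt l))
    {d : ℤ} (hd : d ≠ 0) {Cg : ℝ} (hCg : 1 ≤ Cg)
    (hgy : ∀ i i₀, IsGood d 1 Cg (y₀ i i₀)) (hgα : ∀ i j, IsGood d 1 Cg (α₀ i j : k₀))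
    (hgw : ∀ l, (∀ i, IsGood d 1 Cg ((w₀ l).1 i)) ∧ ∀ j, IsGood d 1 Cg ((w₀ l).2 j)) :
    ∃ (C : ℝ) (S₀ : ℕ), 1 ≤ C ∧ ∀ S : ℕ, S₀ ≤ S →
      ∃ (P : MvPolynomial (Fin d₀ ⊕ Fin d₁) (PadicAlgCl p)) (T : ℕ), P ≠ 0 ∧
        auxDelta C d₀ d₁ n S / Real.log S ≤ T ∧
        (degX P : ℝ) ≤ auxDelta C d₀ d₁ n S / Real.log S ^ 2 ∧
        (degY P : ℝ) ≤ auxDelta C d₀ d₁ n S / S ∧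
        ∀ h : Fin m → ℕ, (∀ i, h i ≤ S) →
          VanishesAlg P (Submodule.span (PadicAlgCl p) (Set.range fun l => Φ.vec (wt l)))
            (gammaOf (fun i => Φ.vec (yt i)) α (Multiplicative.ofAdd fun i => (h i : ℤ))) T := by
  classical
  have hp : p.Prime := Fact.out
  have hp1 : (1 : ℝ) < p := by exact_mod_cast hp.one_lt
  have hp0 : (0 : ℝ) < p := by linarith
  have hlogp : 0 < Real.log p := Real.log_pos hp1
  obtain ⟨a, hcore⟩ := exists_auxiliary_of_params p Φ M hΦM hΦ yt hyt α hα wt hwt e y₀ hy₀ α₀ hα₀ w₀ hw₀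
    hd hCg hgy hgα hgw
  /- constants -/
  set dtot : ℕ := d₀ + d₁ with hdtot
  set dn : ℕ := d₀ + d₁ - n with hdn
  have hdn0 : 0 < dn := by omega
  have hdnn : dn + n = dtot := by omega
  set f : ℕ := finrank ℚ_[p] M with hf
  set Dk : ℕ := finrank ℚ k₀ with hDk
  set dd : ℝ := |(d : ℝ)| with hdd
  have hdd1 : 1 ≤ dd := by rw [hdd, ← Int.cast_abs]; exact_mod_cast Int.one_le_abs hd
  have hCg0 : 0 ≤ Cg := zero_le_one.trans hCg
  set c₁ : ℝ := Real.log (Cg * (d₀ + 1)) with hc₁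
  set c₂ : ℝ := Real.log (dd * (m * Cg + 1)) with hc₂
  set c₃ : ℝ := Real.log (dd ^ 2 * Cg) with hc₃
  have hc₁0 : 0 ≤ c₁ := Real.log_nonneg (one_le_mul_of_one_le_of_one_le hCg (by
    have : (0:ℝ) ≤ d₀ := Nat.cast_nonneg _; linarith))
  have hc₂0 : 0 ≤ c₂ := Real.log_nonneg (one_le_mul_of_one_le_of_one_le hdd1 (by
    have : (0:ℝ) ≤ m * Cg := by positivity
    linarith))
  have hc₃0 : 0 ≤ c₃ := Real.log_nonneg (one_le_mul_of_one_le_of_one_le (one_le_pow₀ hdd1) hCg)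
  set A₀ : ℝ := 5 * dtot + 3 + 2 * (c₁ + 1) + c₂ + m * c₃ with hA₀
  have hA₀0 : 0 ≤ A₀ := by positivity
  set K₀ : ℝ := (max (d₀ : ℝ) 1) ^ d₀ * (max (d₁ : ℝ) 1) ^ d₁ with hK₀
  have hK₀pos : 0 < K₀ := by positivity
  -- `c_L(C) = (Dk (A₀ + 2 log C) + 1)/log p = κa + κb log C`
  set κa : ℝ := ((Dk : ℝ) * A₀ + 1) / Real.log p with hκa
  set κb : ℝ := (2 * (Dk : ℝ)) / Real.log p with hκb
  have hκa0 : 0 ≤ κa := by positivity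
  have hκb0 : 0 ≤ κb := by positivity
  set κ₁ : ℝ := (f : ℝ) * Real.log p * K₀ with hκ₁def
  set κ₂ : ℝ := κa + 2 * a + 3 with hκ₂
  obtain ⟨C, hCe, hC⟩ := exists_large_const κ₁ κ₂ κb (by positivity) (by positivity) hκb0 (n + 1)
  have hC1 : 1 ≤ C := le_trans (by have := Real.add_one_le_exp (1:ℝ); linarith) hCe
  have hCpos : 0 < C := by linarith
  have hlogC : 1 ≤ Real.log C := by
    rw [Real.le_log_iff_exp_le hCpos]; exact hCe
  have hlogC0 : 0 ≤ Real.log C := zero_le_one.trans hlogC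
  set cL : ℝ := κa + κb * Real.log C with hcL
  have hcL0 : 0 ≤ cL := by positivity
  have hcLdef : cL * Real.log p = (Dk : ℝ) * (A₀ + 2 * Real.log C) + 1 := by
    rw [hcL, hκa, hκb]; field_simp; ring
  /- `S` large -/
  have hev : ∀ᶠ S : ℕ in Filter.atTop, 3 ≤ S ∧ Real.log S ^ (2 * dn) ≤ (S : ℝ) :=
    (Filter.eventually_ge_atTop 3).and ((eventually_mul_log_pow_le 1 (2 * dn)).mono fun S h => by
      simpa using h)
  obtain ⟨S₀, hS₀⟩ := Filter.eventually_atTop.1 hev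
  refine ⟨C, S₀, hC1, fun S hS => ?_⟩
  obtain ⟨hS3, hlog2dn⟩ := hS₀ S hS
  /- the real parameters -/
  have hS1 : (1 : ℝ) ≤ S := by exact_mod_cast (show 1 ≤ S by omega)
  have hSpos : (0 : ℝ) < S := by linarith
  set Ls : ℝ := Real.log S with hLs
  have hLs1 : 1 ≤ Ls := by
    rw [hLs, Real.le_log_iff_exp_le hSpos]
    have : (3 : ℝ) ≤ S := by exact_mod_cast hS3
    linarith [Real.exp_one_lt_three]
  have hLspos : 0 < Ls := by linarith
  have hLsS : Ls ≤ S := by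
    rw [hLs]; exact (Real.log_le_sub_one_of_pos hSpos).trans (by linarith)
  set B : ℝ := C * (S : ℝ) ^ d₁ * Ls ^ (2 * d₀) with hB
  have hBpos : 0 < B := by positivity
  set Δ : ℝ := auxDelta C d₀ d₁ n S with hΔdef
  have hΔB : Δ ^ dn = B := by
    rw [hΔdef, LinGroup.auxDelta]
    exact Real.rpow_inv_natCast_pow hBpos.le hdn0.ne'
  have hΔpos : 0 < Δ := by
    rw [hΔdef, LinGroup.auxDelta]; exact Real.rpow_pos_of_pos hBpos _
  have root_le : ∀ {X : ℝ}, X ^ dn ≤ B → X ≤ Δ := fun h =>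
    le_of_pow_le_pow_left₀ hdn0.ne' hΔpos.le (by rwa [hΔB])
  -- `Ls² ≤ Δ`, hence `1 ≤ Δ`, `Ls ≤ Δ`
  have hL2 : Ls ^ 2 ≤ Δ := by
    apply root_le
    rw [← pow_mul]
    by_cases hd₁ : 1 ≤ d₁
    · calc Ls ^ (2 * dn) ≤ S := hlog2dn
        _ = (S : ℝ) ^ 1 := (pow_one _).symm
        _ ≤ (S : ℝ) ^ d₁ := pow_le_pow_right₀ hS1 hd₁
        _ ≤ C * (S : ℝ) ^ d₁ := le_mul_of_one_le_left (by positivity) hC1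
        _ ≤ B := le_mul_of_one_le_right (by positivity) (one_le_pow₀ hLs1)
    · calc Ls ^ (2 * dn) ≤ Ls ^ (2 * d₀) := pow_le_pow_right₀ hLs1 (by omega)
        _ = 1 * 1 * Ls ^ (2 * d₀) := by ring
        _ ≤ C * (S : ℝ) ^ d₁ * Ls ^ (2 * d₀) :=
            mul_le_mul_of_nonneg_right (mul_le_mul hC1 (one_le_pow₀ hS1) zero_le_one hCpos.le)
              (by positivity)
  have hΔ1 : 1 ≤ Δ := le_trans (one_le_pow₀ hLs1) hL2
  have hLsΔ : Ls ≤ Δ := le_trans (by nlinarith) hL2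
  have hΔLs1 : 1 ≤ Δ / Ls := by rw [le_div_iff₀ hLspos, one_mul]; exact hLsΔ
  -- `log Δ ≤ log C + 2 dtot · Ls`
  have hlogΔ : Real.log Δ ≤ Real.log C + 2 * dtot * Ls := by
    have h1 : Δ ^ dn ≤ C * (S : ℝ) ^ (2 * dtot) := by
      rw [hΔB, hB]
      calc C * (S : ℝ) ^ d₁ * Ls ^ (2 * d₀) ≤ C * (S : ℝ) ^ d₁ * (S : ℝ) ^ (2 * d₀) := by gcongr
        _ = C * (S : ℝ) ^ (d₁ + 2 * d₀) := by rw [pow_add]; ring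
        _ ≤ C * (S : ℝ) ^ (2 * dtot) := by
            refine mul_le_mul_of_nonneg_left (pow_le_pow_right₀ hS1 (by omega)) hCpos.le
    have h2 : Real.log (Δ ^ dn) ≤ Real.log (C * (S : ℝ) ^ (2 * dtot)) :=
      Real.log_le_log (pow_pos hΔpos _) h1
    rw [Real.log_pow, Real.log_mul hCpos.ne' (by positivity), Real.log_pow] at h2
    have h3 : Real.log Δ ≤ dn * Real.log Δ :=
      le_mul_of_one_le_left (Real.log_nonneg hΔ1) (by exact_mod_cast hdn0)
    refine h3.trans (h2.trans (le_of_eq ?_))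
    push_cast; ring
  /- the integer parameters -/
  set T : ℕ := ⌈Δ / Ls⌉₊ with hTdef
  set D₀ : ℕ := ⌊Δ / Ls ^ 2⌋₊ with hD₀def
  set D₁ : ℕ := ⌊Δ / S⌋₊ with hD₁def
  set L : ℕ := ⌈cL * Δ⌉₊ with hLdef
  set Q : ℕ := ⌈Real.exp Δ⌉₊ with hQdef
  have hT : Δ / Ls ≤ T := Nat.le_ceil _
  have hTle : (T : ℝ) ≤ 2 * Δ / Ls := by
    have h1 : (T : ℝ) < Δ / Ls + 1 := Nat.ceil_lt_add_one (by positivity)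
    have h2 : Δ / Ls + 1 ≤ 2 * Δ / Ls := by rw [two_mul, add_div]; linarith
    linarith
  have hTle' : (T : ℝ) ≤ 2 * Δ := by
    refine hTle.trans ?_
    rw [div_le_iff₀ hLspos]; nlinarith
  have hD₀ : (D₀ : ℝ) ≤ Δ / Ls ^ 2 := Nat.floor_le (by positivity)
  have hD₀' : Δ / Ls ^ 2 < D₀ + 1 := Nat.lt_floor_add_one _
  have hD₀Δ : (D₀ : ℝ) ≤ Δ := hD₀.trans (div_le_self hΔpos.le (one_le_pow₀ hLs1))
  have hD₁ : (D₁ : ℝ) ≤ Δ / S := Nat.floor_le (by positivity)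
  have hD₁' : Δ / S < D₁ + 1 := Nat.lt_floor_add_one _
  have hD₁Δ : (D₁ : ℝ) ≤ Δ := hD₁.trans (div_le_self hΔpos.le hS1)
  have hSD₁ : (S : ℝ) * D₁ ≤ Δ := by rwa [← le_div_iff₀' hSpos]
  have hL : cL * Δ ≤ L := Nat.le_ceil _
  have hLle : (L : ℝ) ≤ cL * Δ + 1 := (Nat.ceil_lt_add_one (by positivity)).le
  have hQ : Real.exp Δ ≤ Q := Nat.le_ceil _
  have hQle : (Q : ℝ) ≤ Real.exp Δ + 1 := (Nat.ceil_lt_add_one (by positivity)).le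
  have hexpΔ1 : 1 ≤ Real.exp Δ := Real.one_le_exp hΔpos.le
  have hQ1 : (1 : ℝ) ≤ Q := hexpΔ1.trans hQ
  have hQ1' : 1 ≤ Q := by exact_mod_cast hQ1
  have hlogQ : Real.log Q ≤ 2 * Δ := by
    calc Real.log Q ≤ Real.log (2 * Real.exp Δ) :=
          Real.log_le_log (by linarith) (by linarith)
      _ = Real.log 2 + Δ := by rw [Real.log_mul two_ne_zero (Real.exp_pos _).ne', Real.log_exp]
      _ ≤ 2 * Δ := by linarith [Real.log_two_lt_d9]
  have hlogQ1 : Δ ≤ Real.log (Q + 1) := by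
    calc Δ = Real.log (Real.exp Δ) := (Real.log_exp Δ).symm
      _ ≤ Real.log (Q + 1) := Real.log_le_log (Real.exp_pos _) (by linarith)
  /- (P1) the box-principle count -/
  have hP1 : p ^ (f * (L + 2 * a) * (L + T) ^ n) < (Q + 1) ^ ((D₀ / d₀ + 1) ^ d₀ * (D₁ / d₁ + 1) ^ d₁) := by
    apply pow_lt_pow_of_log hp.pos (by omega)
    -- the left side
    set X : ℝ := (f : ℝ) * Real.log p * ((cL + 2 * a + 1) * (cL + 3) ^ n) with hX
    have hLa : ((L + 2 * a : ℕ) : ℝ) ≤ (cL + 2 * a + 1) * Δ := by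
      push_cast
      have : (1 : ℝ) + 2 * a ≤ (2 * a + 1) * Δ := by nlinarith
      nlinarith
    have hLT : ((L + T : ℕ) : ℝ) ≤ (cL + 3) * Δ := by
      push_cast; nlinarith
    have hleft : ((f * (L + 2 * a) * (L + T) ^ n : ℕ) : ℝ) * Real.log p ≤ X * Δ ^ (n + 1) := by
      have h1 : ((f * (L + 2 * a) * (L + T) ^ n : ℕ) : ℝ) =
          (f : ℝ) * ((L + 2 * a : ℕ) : ℝ) * ((L + T : ℕ) : ℝ) ^ n := by push_cast; ring
      rw [h1, hX]
      have h2 : ((L + T : ℕ) : ℝ) ^ n ≤ ((cL + 3) * Δ) ^ n := pow_le_pow_left₀ (by positivity) hLT n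
      calc (f : ℝ) * ((L + 2 * a : ℕ) : ℝ) * ((L + T : ℕ) : ℝ) ^ n * Real.log p
          ≤ (f : ℝ) * ((cL + 2 * a + 1) * Δ) * ((cL + 3) * Δ) ^ n * Real.log p := by
            gcongr
        _ = (f : ℝ) * Real.log p * ((cL + 2 * a + 1) * (cL + 3) ^ n) * Δ ^ (n + 1) := by
            rw [mul_pow, pow_succ]; ring
    -- `X K₀ < C`
    have hXC : X * K₀ < C := by
      have h1 : (cL + 2 * a + 1) * (cL + 3) ^ n ≤ (κ₂ + κb * Real.log C) ^ (n + 1) := by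
        have h2 : cL + 2 * a + 1 ≤ κ₂ + κb * Real.log C := by rw [hcL, hκ₂]; linarith
        have h3 : cL + 3 ≤ κ₂ + κb * Real.log C := by
          rw [hcL, hκ₂]; nlinarith [show (0:ℝ) ≤ a from Nat.cast_nonneg a]
        rw [pow_succ, mul_comm]
        exact mul_le_mul (pow_le_pow_left₀ (by positivity) h3 n) h2 (by positivity) (by positivity)
      calc X * K₀ = κ₁ * ((cL + 2 * a + 1) * (cL + 3) ^ n) := by rw [hX, hκ₁def]; ring
        _ ≤ κ₁ * (κ₂ + κb * Real.log C) ^ (n + 1) := mul_le_mul_of_nonneg_left h1 (by positivity)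
        _ < C := hC
    -- the right side: `U ≥ Δ^{dtot}/(K₀ Ls^{2d₀} S^{d₁})`
    have hU₀ : (Δ / ((max (d₀ : ℝ) 1) * Ls ^ 2)) ^ d₀ ≤ (((D₀ / d₀ : ℕ) : ℝ) + 1) ^ d₀ := by
      rcases Nat.eq_zero_or_pos d₀ with hd0 | hd0
      · rw [hd0, pow_zero, pow_zero]
      · refine pow_le_pow_left₀ (by positivity) ?_ d₀
        have hd0r : (1 : ℝ) ≤ d₀ := by exact_mod_cast hd0
        have hmax : max (d₀ : ℝ) 1 = d₀ := max_eq_left hd0r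
        rw [hmax]
        have hd0' : (0 : ℝ) < d₀ := by linarith
        have h1 : (D₀ : ℝ) + 1 ≤ (((D₀ / d₀ : ℕ) : ℝ) + 1) * d₀ := by
          have h2 : D₀ < D₀ / d₀ * d₀ + d₀ := Nat.lt_div_mul_add hd0
          have h3 : D₀ + 1 ≤ (D₀ / d₀ + 1) * d₀ := by rw [Nat.add_mul, one_mul]; omega
          have h4 : ((D₀ + 1 : ℕ) : ℝ) ≤ (((D₀ / d₀ + 1) * d₀ : ℕ) : ℝ) := by exact_mod_cast h3
          push_cast at h4
          exact h4
        rw [div_le_iff₀ (by positivity)]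
        calc Δ = Δ / Ls ^ 2 * Ls ^ 2 := by field_simp
          _ ≤ ((D₀ : ℝ) + 1) * Ls ^ 2 := mul_le_mul_of_nonneg_right hD₀'.le (by positivity)
          _ ≤ ((((D₀ / d₀ : ℕ) : ℝ) + 1) * d₀) * Ls ^ 2 := mul_le_mul_of_nonneg_right h1 (by positivity)
          _ = (((D₀ / d₀ : ℕ) : ℝ) + 1) * ((d₀ : ℝ) * Ls ^ 2) := by ring
    have hU₁ : (Δ / ((max (d₁ : ℝ) 1) * S)) ^ d₁ ≤ (((D₁ / d₁ : ℕ) : ℝ) + 1) ^ d₁ := by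
      rcases Nat.eq_zero_or_pos d₁ with hd1 | hd1
      · rw [hd1, pow_zero, pow_zero]
      · refine pow_le_pow_left₀ (by positivity) ?_ d₁
        have hd1r : (1 : ℝ) ≤ d₁ := by exact_mod_cast hd1
        have hmax : max (d₁ : ℝ) 1 = d₁ := max_eq_left hd1r
        rw [hmax]
        have hd1' : (0 : ℝ) < d₁ := by linarith
        have h1 : (D₁ : ℝ) + 1 ≤ (((D₁ / d₁ : ℕ) : ℝ) + 1) * d₁ := by
          have h2 : D₁ < D₁ / d₁ * d₁ + d₁ := Nat.lt_div_mul_add hd1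
          have h3 : D₁ + 1 ≤ (D₁ / d₁ + 1) * d₁ := by rw [Nat.add_mul, one_mul]; omega
          have h4 : ((D₁ + 1 : ℕ) : ℝ) ≤ (((D₁ / d₁ + 1) * d₁ : ℕ) : ℝ) := by exact_mod_cast h3
          push_cast at h4
          exact h4
        rw [div_le_iff₀ (by positivity)]
        calc Δ = Δ / S * S := by field_simp
          _ ≤ ((D₁ : ℝ) + 1) * S := mul_le_mul_of_nonneg_right hD₁'.le (by positivity)
          _ ≤ ((((D₁ / d₁ : ℕ) : ℝ) + 1) * d₁) * S := mul_le_mul_of_nonneg_right h1 (by positivity)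
          _ = (((D₁ / d₁ : ℕ) : ℝ) + 1) * ((d₁ : ℝ) * S) := by ring
    have hK₀Ls : 0 < K₀ * Ls ^ (2 * d₀) * (S : ℝ) ^ d₁ := by positivity
    have hU : Δ ^ dtot / (K₀ * Ls ^ (2 * d₀) * (S : ℝ) ^ d₁) ≤
        (((D₀ / d₀ + 1) ^ d₀ * (D₁ / d₁ + 1) ^ d₁ : ℕ) : ℝ) := by
      have e1 : Δ ^ dtot / (K₀ * Ls ^ (2 * d₀) * (S : ℝ) ^ d₁) =
          (Δ / ((max (d₀ : ℝ) 1) * Ls ^ 2)) ^ d₀ * (Δ / ((max (d₁ : ℝ) 1) * S)) ^ d₁ := by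
        rw [hK₀, hdtot, pow_add, div_pow, div_pow, mul_pow, mul_pow, ← pow_mul]
        field_simp
      rw [e1]
      push_cast
      exact mul_le_mul hU₀ hU₁ (by positivity) (by positivity)
    -- combine
    have hright : Δ ^ dtot / (K₀ * Ls ^ (2 * d₀) * (S : ℝ) ^ d₁) * Δ ≤
        (((D₀ / d₀ + 1) ^ d₀ * (D₁ / d₁ + 1) ^ d₁ : ℕ) : ℝ) * Real.log ((Q + 1 : ℕ) : ℝ) := by
      push_cast
      refine mul_le_mul ?_ hlogQ1 hΔpos.le (by positivity)
      have := hU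
      push_cast at this
      exact this
    have hmid : X * Δ ^ (n + 1) < Δ ^ dtot / (K₀ * Ls ^ (2 * d₀) * (S : ℝ) ^ d₁) * Δ := by
      rw [div_mul_eq_mul_div, lt_div_iff₀ hK₀Ls]
      have hpos : 0 < Ls ^ (2 * d₀) * (S : ℝ) ^ d₁ * Δ ^ (n + 1) := by positivity
      calc X * Δ ^ (n + 1) * (K₀ * Ls ^ (2 * d₀) * (S : ℝ) ^ d₁)
          = (X * K₀) * (Ls ^ (2 * d₀) * (S : ℝ) ^ d₁ * Δ ^ (n + 1)) := by ring
        _ < C * (Ls ^ (2 * d₀) * (S : ℝ) ^ d₁ * Δ ^ (n + 1)) := mul_lt_mul_of_pos_right hXC hpos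
        _ = Δ ^ dn * Δ ^ (n + 1) := by rw [hΔB, hB]; ring
        _ = Δ ^ dtot * Δ := by rw [← hdnn]; ring
    exact lt_of_le_of_lt hleft (hmid.trans_le hright)
  /- (P2) the Liouville count -/
  have hP2 : ∀ ℓ : ℕ, ℓ < T →
      ((((max D₀ D₁ + 1) ^ (d₀ + d₁) : ℕ) : ℝ) * ((Q : ℝ) * (Cg * ((d₀ : ℝ) * (D₀ + 1) + D₁ + 1)) ^ ℓ *
        (((|(d : ℝ)|) * ((m : ℝ) * S * Cg + 1)) ^ D₀ * ((|(d : ℝ)|) ^ 2 * Cg) ^ (m * S * D₁)))) ^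
          finrank ℚ k₀ < (p : ℝ) ^ L := by
    intro ℓ hℓ
    rw [← hdd, ← hDk, ← hdtot]
    set Kf : ℝ := Cg * ((d₀ : ℝ) * (D₀ + 1) + D₁ + 1) with hKf
    set XB₀ : ℝ := dd * ((m : ℝ) * S * Cg + 1) with hXB₀
    set YB₀ : ℝ := dd ^ 2 * Cg with hYB₀
    set N₂ : ℝ := (((max D₀ D₁ + 1) ^ dtot : ℕ) : ℝ) with hN₂
    have hbr1 : (1 : ℝ) ≤ (d₀ : ℝ) * (D₀ + 1) + D₁ + 1 := by
      have : (0 : ℝ) ≤ (d₀ : ℝ) * (D₀ + 1) + D₁ := by positivity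
      linarith
    have hKf1 : 1 ≤ Kf := one_le_mul_of_one_le_of_one_le hCg hbr1
    have hKfpos : 0 < Kf := by linarith
    have hXB₀1 : 1 ≤ XB₀ := one_le_mul_of_one_le_of_one_le hdd1 (by
      have : (0 : ℝ) ≤ (m : ℝ) * S * Cg := by positivity
      linarith)
    have hYB₀1 : 1 ≤ YB₀ := one_le_mul_of_one_le_of_one_le (one_le_pow₀ hdd1) hCg
    have hN₂1 : 1 ≤ N₂ := by rw [hN₂]; exact_mod_cast Nat.one_le_pow _ _ (Nat.succ_pos _)
    have hN₂pos : 0 < N₂ := by linarith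
    have hQpos : (0 : ℝ) < Q := by linarith
    -- the logarithms
    have hlogN₂ : Real.log N₂ ≤ dtot * Δ := by
      have h1 : N₂ = ((max D₀ D₁ : ℕ) + 1 : ℝ) ^ dtot := by rw [hN₂]; push_cast; ring
      rw [h1, Real.log_pow]
      refine mul_le_mul_of_nonneg_left ?_ (Nat.cast_nonneg _)
      have hmax : ((max D₀ D₁ : ℕ) : ℝ) ≤ Δ := by
        rw [Nat.cast_max]; exact max_le hD₀Δ hD₁Δ
      calc Real.log ((max D₀ D₁ : ℕ) + 1 : ℝ) ≤ Real.log (Δ + 1) :=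
            Real.log_le_log (by positivity) (by linarith)
        _ ≤ Δ := log_add_one_le hΔpos.le
    have hlogKf : Real.log Kf ≤ c₁ + 1 + Real.log C + 2 * dtot * Ls := by
      have h1 : Kf ≤ Cg * ((d₀ : ℝ) + 1) * (Δ + 1) := by
        rw [hKf, mul_assoc]
        refine mul_le_mul_of_nonneg_left ?_ hCg0
        have hd0 : (0 : ℝ) ≤ d₀ := Nat.cast_nonneg _
        nlinarith only [hD₀Δ, hD₁Δ, hd0, hΔpos]
      have hCd : 0 < Cg * ((d₀ : ℝ) + 1) := by positivity
      have h2 : Real.log Kf ≤ Real.log (Cg * ((d₀ : ℝ) + 1)) + Real.log (Δ + 1) := by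
        rw [← Real.log_mul hCd.ne' (by linarith only [hΔpos])]
        exact Real.log_le_log hKfpos h1
      have h3 : Real.log (Δ + 1) ≤ 1 + Real.log C + 2 * dtot * Ls := by
        calc Real.log (Δ + 1) ≤ Real.log (2 * Δ) :=
              Real.log_le_log (by linarith only [hΔpos]) (by linarith only [hΔ1])
          _ = Real.log 2 + Real.log Δ := Real.log_mul two_ne_zero hΔpos.ne'
          _ ≤ 1 + Real.log C + 2 * dtot * Ls := by linarith only [Real.log_two_lt_d9, hlogΔ]
      rw [hc₁]; linarith only [h2, h3]
    have hlogKf0 : 0 ≤ Real.log Kf := Real.log_nonneg hKf1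
    have hℓT : (ℓ : ℝ) ≤ T := by exact_mod_cast hℓ.le
    have hterm2 : (ℓ : ℝ) * Real.log Kf ≤ 2 * Δ * (c₁ + 1 + Real.log C) + 4 * dtot * Δ := by
      have h0 : 0 ≤ 2 * Δ * (c₁ + 1 + Real.log C) := by positivity
      have hd0 : 0 ≤ 2 * Δ / Ls := by positivity
      calc (ℓ : ℝ) * Real.log Kf ≤ T * Real.log Kf := mul_le_mul_of_nonneg_right hℓT hlogKf0
        _ ≤ (2 * Δ / Ls) * (c₁ + 1 + Real.log C + 2 * dtot * Ls) :=
            mul_le_mul hTle hlogKf hlogKf0 hd0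
        _ = 2 * Δ * (c₁ + 1 + Real.log C) / Ls + 4 * dtot * Δ := by field_simp; ring
        _ ≤ 2 * Δ * (c₁ + 1 + Real.log C) + 4 * dtot * Δ := by
            linarith only [div_le_self h0 hLs1]
    have hddpos : 0 < dd := lt_of_lt_of_le zero_lt_one hdd1
    have hmCg : (0 : ℝ) ≤ (m : ℝ) * Cg := mul_nonneg (Nat.cast_nonneg _) hCg0
    have hmCg1 : (0 : ℝ) < (m : ℝ) * Cg + 1 := by linarith only [hmCg]
    have hXB₀pos : 0 < XB₀ := lt_of_lt_of_le zero_lt_one hXB₀1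
    have hlogXB₀ : Real.log XB₀ ≤ c₂ + Ls := by
      have h1 : XB₀ ≤ dd * (((m : ℝ) * Cg + 1) * S) := by
        rw [hXB₀]
        refine mul_le_mul_of_nonneg_left ?_ hddpos.le
        nlinarith only [hS1, hmCg]
      calc Real.log XB₀ ≤ Real.log (dd * (((m : ℝ) * Cg + 1) * S)) := Real.log_le_log hXB₀pos h1
        _ = c₂ + Ls := by
            rw [Real.log_mul hddpos.ne' (mul_pos hmCg1 hSpos).ne', Real.log_mul hmCg1.ne' hSpos.ne', hc₂,
              Real.log_mul hddpos.ne' hmCg1.ne', hLs]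
            ring
    have hterm3 : (D₀ : ℝ) * Real.log XB₀ ≤ Δ * c₂ + Δ := by
      have hlogXB₀0 : 0 ≤ Real.log XB₀ := Real.log_nonneg hXB₀1
      calc (D₀ : ℝ) * Real.log XB₀ ≤ (Δ / Ls ^ 2) * (c₂ + Ls) :=
            mul_le_mul hD₀ hlogXB₀ hlogXB₀0 (by positivity)
        _ = Δ * c₂ / Ls ^ 2 + Δ / Ls := by field_simp
        _ ≤ Δ * c₂ + Δ := by
            have h0 : 0 ≤ Δ * c₂ := mul_nonneg hΔpos.le hc₂0
            have h1 : Δ * c₂ / Ls ^ 2 ≤ Δ * c₂ := div_le_self h0 (one_le_pow₀ hLs1)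
            have h2 : Δ / Ls ≤ Δ := div_le_self hΔpos.le hLs1
            linarith only [h1, h2]
    have hterm4 : ((m * S * D₁ : ℕ) : ℝ) * Real.log YB₀ ≤ m * Δ * c₃ := by
      push_cast
      have : Real.log YB₀ = c₃ := by rw [hc₃, hYB₀]
      rw [this]
      have h0 : 0 ≤ (m : ℝ) * c₃ := by positivity
      calc (m : ℝ) * S * D₁ * c₃ = ((S : ℝ) * D₁) * (m * c₃) := by ring
        _ ≤ Δ * (m * c₃) := mul_le_mul_of_nonneg_right hSD₁ h0
        _ = m * Δ * c₃ := by ring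
    -- the total
    have hYB₀pos : 0 < YB₀ := lt_of_lt_of_le zero_lt_one hYB₀1
    have hKfℓ : 0 < Kf ^ ℓ := pow_pos hKfpos _
    have hXBD : 0 < XB₀ ^ D₀ := pow_pos hXB₀pos _
    have hYBm : 0 < YB₀ ^ (m * S * D₁) := pow_pos hYB₀pos _
    have hBpos' : 0 < N₂ * ((Q : ℝ) * Kf ^ ℓ * (XB₀ ^ D₀ * YB₀ ^ (m * S * D₁))) :=
      mul_pos hN₂pos (mul_pos (mul_pos hQpos hKfℓ) (mul_pos hXBD hYBm))
    have hlogB : Real.log (N₂ * ((Q : ℝ) * Kf ^ ℓ * (XB₀ ^ D₀ * YB₀ ^ (m * S * D₁)))) ≤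
        (A₀ + 2 * Real.log C) * Δ := by
      rw [Real.log_mul hN₂pos.ne' (mul_pos (mul_pos hQpos hKfℓ) (mul_pos hXBD hYBm)).ne',
        Real.log_mul (mul_pos hQpos hKfℓ).ne' (mul_pos hXBD hYBm).ne',
        Real.log_mul hQpos.ne' hKfℓ.ne', Real.log_mul hXBD.ne' hYBm.ne',
        Real.log_pow, Real.log_pow, Real.log_pow]
      rw [hA₀]
      have h0 : (0 : ℝ) ≤ dtot := Nat.cast_nonneg _
      have h5 : 0 ≤ Δ * Real.log C := mul_nonneg hΔpos.le hlogC0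
      linarith only [hlogN₂, hlogQ, hterm2, hterm3, hterm4, hΔpos.le, hlogC0, h0, h5]
    have hfinal : (Dk : ℝ) * Real.log (N₂ * ((Q : ℝ) * Kf ^ ℓ * (XB₀ ^ D₀ * YB₀ ^ (m * S * D₁)))) <
        L * Real.log p := by
      have h1 : (Dk : ℝ) * Real.log (N₂ * ((Q : ℝ) * Kf ^ ℓ * (XB₀ ^ D₀ * YB₀ ^ (m * S * D₁)))) ≤
          (Dk : ℝ) * ((A₀ + 2 * Real.log C) * Δ) := mul_le_mul_of_nonneg_left hlogB (Nat.cast_nonneg _)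
      have h2 : (Dk : ℝ) * ((A₀ + 2 * Real.log C) * Δ) < cL * Real.log p * Δ := by
        rw [hcLdef]
        have : (Dk : ℝ) * ((A₀ + 2 * Real.log C) * Δ) + Δ = ((Dk : ℝ) * (A₀ + 2 * Real.log C) + 1) * Δ := by
          ring
        linarith only [this, hΔpos]
      have h3 : cL * Real.log p * Δ ≤ L * Real.log p := by
        calc cL * Real.log p * Δ = (cL * Δ) * Real.log p := by ring
          _ ≤ L * Real.log p := mul_le_mul_of_nonneg_right hL hlogp.le
      linarith only [h1, h2, h3]
    rw [← Real.log_lt_log_iff (pow_pos hBpos' _) (pow_pos hp0 _), Real.log_pow, Real.log_pow]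
    exact hfinal
  /- the polynomial -/
  obtain ⟨P, hPne, hPX, hPY, hvan⟩ := hcore S D₀ D₁ T L Q hP1 hP2
  refine ⟨P, T, hPne, hT, ?_, ?_, hvan⟩
  · exact le_trans (by exact_mod_cast hPX) hD₀
  · exact le_trans (by exact_mod_cast hPY) hD₁

end AF

end LinGroupK

end Literature.NumberTheory.Transcendental
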